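import Mathlib
import Literature.NumberTheory.EllipticCurves.Rank1Residual.PPartGoodOrdinarySurj
import Literature.NumberTheory.EllipticCurves.ExceptionalPrimesDensityModels
import Literature.NumberTheory.EllipticCurves.HeightDensityLemmas
import Literature.NumberTheory.EllipticCurves.PPartBSDGoodOrdinaryRankLeOne
import Literature.NumberTheory.EllipticCurves.BhargavaSkinnerZhang2014.CellUnion
import Literature.NumberTheory.EllipticCurves.LeadingTermBSZReductionTypesProofs
import Literature.NumberTheory.EllipticCurves.BSDSelmerSkinnerThmBProofs
import Literature.NumberTheory.EllipticCurves.BSDInvariantsProofs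
import Literature.NumberTheory.EllipticCurves.LeadingTerm
import Literature.NumberTheory.EllipticCurves.ModularCurveManinSemistableCoprimeFormProofs
import Literature.NumberTheory.EllipticCurves.SzpiroMinimalityProofs
import Literature.NumberTheory.EllipticCurves.NeronLocalHeightCompletion
import HarnessLib

/-!
# The full BSD formula off `S_go′(E)` for a proportion `≥ c` of elliptic curves over `ℚ` by height

Typed form of row (ii-1) of `PERCENT-FULL.md` (cell `pub-bsdpct`, summit BirchSwinnertonDyer): a
TRANSFER theorem from the rank part of BSD to the full BSD formula at every prime outside an explicit
finite set, over the height-ordered family `E_{A,B} : y² = x³ + Ax + B`.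

For an elliptic curve `E/ℚ` with global minimal model `W` put
`Z*(E) := {p : ∃ ℓ ∥ N_E, ℓ ≡ ±1 (mod p), p ∣ v_ℓ(Δ_min)}` (`InZstar`; a finite set,
`finite_setOf_inZstar`) and `S_go′(E) := {2, 3} ∪ {p : E has bad or good supersingular reduction at p}
∪ Z*(E)`. The main theorem `HeightDensityGE.rankLeOne_and_fullBSDOffSgoPrime` says: if at least a
proportion `c` of curves `E_{A,B}` (ordered by naive height, lower density `HeightDensityGE`) satisfy
the rank part of BSD with analytic rank `≤ 1` (`SatisfiesBSDRankLeOne`), then at least the same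
proportion `c` satisfy the rank part AND Miller's `BSD(E,p)` (`BSDp`) at every prime `p ∉ S_go′(E)`
(`FullBSDOffSgoPrime`), GIVEN

* (F1) Duke 1997, Thm. 1 — no exceptional primes for almost all curves
  (`Duke1997_exceptionalPrimes_densityZero`, consumed through the tree theorem
  `heightDensityGE_forall_surj_of_duke`);
* (F3) the HYPOTHESIS `hF3 : HeightDensityGE TwoOrdOnePrimes 1` — almost all `(A, B)` have two
  primes `ℓ₁ ≠ ℓ₂`, `ℓ_i ≥ 5`, with `ord_{ℓ_i}(4A³ + 27B²) = 1`. This is the `p`-UNIFORM conclusion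
  of the ARGUMENT of Bhargava–Skinner–Zhang 2014, Lemma 20 (whose printed STATEMENT is for each fixed
  `p`, and whose printed proof needs the correction recorded in the tree,
  `LeadingTermBSZMuDiffProofs` "Remark on the source"); it is NOT vendored as a named fact here — it
  is an explicit hypothesis, to be discharged by a sieve over the height family (prover target; the
  local densities are `(ℓ-1)²/ℓ³ · (1-ℓ⁻¹⁰)⁻¹`, cf. `BSZMuDiff.hasHeightDensity_not_dvd_and_pow_dvd_disc`);
* bsd.S30 Skinner–Urban 2014 Thm. 2 (a) (`padicValRat_bsd_rank_zero`), W. Zhang 2014 Thm. 1.6/1.4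
  (`WZhang2014_padicValRat_bsd_rank_one_ordinary`), modularity (`hasEntireLFunction_rat`) and
  Gross–Zagier–Kolyvagin (`rank_eq_analyticRank_of_analyticRank_le_one`),

the pointwise step being the tree theorem `Rank1Residual.bsdp_of_S30_of_WZhang2014` (P1′ of
`PERCENT-FULL.md` §(ii).2). The density algebra is the tree's: `HeightDensityGE.and_of_one`
(intersecting with a density-one property costs nothing) and `HeightDensityGE.mono`.

Instances recorded: at the printed Bhargava–Skinner–Zhang constant (bsd.S27,
`bhargava_skinner_zhang : HeightDensityGE SatisfiesBSDRankLeOne 0.6648`, a named fact — see its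
docstring for the caveat on the constant) and at `c_rank = 3059480216411717/4576171406400000 =
0.66856…` (Theorem A′ of the cell's bundle, package `BSDPercentage`, NOT in the tree — kept as a
hypothesis). No constant is proved here: the file proves that the (ii-1) proportion equals whatever
rank-part proportion is supplied.

PROVED here (no `sorry`, standard axioms): `finite_setOf_inZstar`,
`hasMultiplicativeReductionAtPrime_smul_shortWeierstrass_of_padicValInt_eq_one` (ord_ℓ = 1 at
`ℓ ≥ 5` ⇒ multiplicative reduction of every model, from the tree's BSZ Lemma 17 criteria),
(T) `padicValInt_minimalDiscriminantInt_smul_shortWeierstrass` — `v_ℓ(Δ_min) = ord_ℓ(4A³ + 27B²)`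
at `ℓ ≥ 5` for `(A, B)` in the family and any globally minimal model (Silverman VII.1.3(b) with VII.1
Rem. 1.1, from the tree's `isMinimalAt_shortWeierstrass`, `IsGloballyMinimal.isMinimalAt_int`,
`valuation_Δ_smul_le_of_isMinimalAt` and `Rat.HeightOneSpectrum.valuation_eq_exp_neg_padicValRat`),
the transfer theorem and its two instances. NO named fact and NO definition of a closed `Prop` is
introduced (D-0026 debt 0): the only new definitions are the predicates `InZstar`, `FullBSDOffSgoPrime`,
`TwoOrdOnePrimes` on curves / pairs.

References.
* M. Bhargava, C. Skinner, W. Zhang, *A majority of elliptic curves over ℚ satisfy the Birch and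
  Swinnerton-Dyer conjecture*, arXiv:1407.1826 (2014), Lemma 17 (proof), Lemma 20 (proof).
* W. Duke, *Elliptic curves with no exceptional primes*, C. R. Acad. Sci. Paris 325 (1997) 813–818, Thm. 1.
* C. Skinner, E. Urban, *The Iwasawa main conjectures for GL₂*, Invent. Math. 195 (2014), Thm. 2 (a).
* W. Zhang, *Selmer groups and the indivisibility of Heegner points*, Camb. J. Math. 2 (2014), Thm. 1.4, 1.6.
* J. H. Silverman, *The Arithmetic of Elliptic Curves*, GTM 106 (2009), VII.1 Prop. 1.3(b), Rem. 1.1; VIII.8.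
* R. L. Miller, *Proving the Birch and Swinnerton-Dyer conjecture for specific elliptic curves of
  analytic rank zero and one*, LMS J. Comput. Math. 14 (2011), Def. 1.1 (`BSDp`).
-/
noncomputable section

open scoped Classical
open WeierstrassCurve Filter Topology Literature.NumberTheory.EllipticCurves

namespace Literature.NumberTheory.EllipticCurves

/-! ### The exceptional set `Z*(E)` and the property "full BSD off `S_go′(E)`" -/

/-- `p ∈ Z*(E)`: some prime `ℓ` of multiplicative reduction of the globally minimal model `W`
(`ℓ ∥ N`) with `ℓ ≡ ±1 (mod p)` — `p ∣ ℓ - 1` or `p ∣ ℓ + 1` — has `p ∣ v_ℓ(Δ_min)`; i.e. hypothesis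
(2) of W. Zhang 2014, Thm. 1.4 fails at `p` (Tate: `ρ̄_{E,p}` is then unramified at `ℓ`). This is the
negation of the binder `hZstar` of `Rank1Residual.bsdp_of_S30_of_WZhang2014`.
[cite: WZhang2014, Thm. 1.4 (p. 197), hypothesis (2)] -/
def InZstar (W : WeierstrassCurve ℚ) [W.IsGloballyMinimal] (p : ℕ) : Prop :=
  ∃ ℓ : ℕ, ∃ _ : Fact ℓ.Prime, W.HasMultiplicativeReductionAtPrime ℓ ∧
    (p ∣ ℓ - 1 ∨ p ∣ ℓ + 1) ∧ p ∣ padicValInt ℓ W.minimalDiscriminantInt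

/-- **`Z*(E)` is finite**: it is contained in the finite set of the tree theorem
`WZhang2014_exceptionalPrimes_finite` (`p ∣ v_ℓ(Δ_min)` for some `ℓ ∣ Δ_min ≠ 0`). [folklore] -/
theorem finite_setOf_inZstar (W : WeierstrassCurve ℚ) [W.IsElliptic] [W.IsGloballyMinimal] :
    {p : ℕ | InZstar W p}.Finite :=
  WZhang2014_exceptionalPrimes_finite W

/-- **The full BSD formula off `S_go′(E)`** for the curve `E_{A,B}`: for every globally minimal
model `W = C • E_{A,B}` and every prime `p ≥ 5` at which `W` has good ordinary reduction
(`Rank1Residual.GoodOrd`: good reduction and `p ∤ a_p`) and `p ∉ Z*(E)`, Miller's `BSD(E,p)` holds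
(`BSDp W p`: `rk E(ℚ) = r_an`, `Ш[p^∞]` finite, `ord_p #Ш_an = ord_p #Ш[p^∞]`). Row (ii-1) of
`PERCENT-FULL.md`: `S_go′(E) = {2,3} ∪ {bad or supersingular p} ∪ Z*(E)`.
[cite: Miller2011LMS, Def. 1.1 (arXiv:1010.2431 p. 3)] -/
def FullBSDOffSgoPrime (AB : ℤ × ℤ) : Prop :=
  ∀ (W : WeierstrassCurve ℚ) [W.IsElliptic] [W.IsGloballyMinimal] (C : VariableChange ℚ),
    C • shortWeierstrass AB = W → ∀ (p : ℕ) [Fact p.Prime], 5 ≤ p →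
      Rank1Residual.GoodOrd W p → ¬ InZstar W p → BSDp W p

/-! ### The two-exact-primes set (the complement of `S(L)` in the proof of BSZ Lemma 20) -/

/-- **The pairs `(A, B)` with two primes `ℓ₁ ≠ ℓ₂`, `ℓ_i ≥ 5`, dividing `4A³ + 27B²` exactly once**
(`ord_{ℓ_i}(4A³ + 27B²) = 1`; for `ℓ ≥ 5`, `ord_ℓ(Δ(E_{A,B})) = ord_ℓ(-16(4A³ + 27B²)) =
ord_ℓ(4A³ + 27B²)`). DEFINITION ONLY. In the proof of Lemma 20 of Bhargava–Skinner–Zhang (p. 10: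
"For a large integer `L` and for each prime `5 ≤ ℓ ≤ L`, `ℓ ≠ p`, let `S(L,ℓ)` be the set of elliptic
curves `E_{A,B}` such that `ord_ℓ(Δ(A,B)) ≤ 1` and for all primes `5 ≤ q ≤ L` with `q ∉ {ℓ,p}`, we have
`ord_q(Δ(A,B)) ≠ 1`. Let `S(L) = ∪ S(L,ℓ)`. Any curve in the complement of `S(L)` satisfies the second
property of the lemma with two primes `5 ≤ ℓ₁, ℓ₂ ≤ L`.") these pairs contain the complement of
`S(L)`; the printed STATEMENT of Lemma 20 is per fixed `p` ("Let `p` be any prime. Then … density of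
`100%` … at least two prime factors `ℓ ∣∣ N(E)`, `ℓ ≠ p`, such that `E[p]` is ramified at `ℓ`"), and
the tree records (`LeadingTermBSZMuDiffProofs`, "Remark on the source") that the printed measure
computation needs `ord_ℓ(Δ) = 1` in place of `≤ 1` to go through. The `p`-uniform density-one
statement `HeightDensityGE TwoOrdOnePrimes 1` is therefore NOT recorded as a named fact: it is the
explicit hypothesis `hF3` of `HeightDensityGE.rankLeOne_and_fullBSDOffSgoPrime` (a prover target:
an elementary sieve over the height family). [cite: BhargavaSkinnerZhang2014, Lemma 20 (proof, p. 10)] -/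
def TwoOrdOnePrimes (AB : ℤ × ℤ) : Prop :=
  ∃ ℓ₁ ℓ₂ : ℕ, ℓ₁.Prime ∧ ℓ₂.Prime ∧ 5 ≤ ℓ₁ ∧ 5 ≤ ℓ₂ ∧ ℓ₁ ≠ ℓ₂ ∧
    padicValInt ℓ₁ (4 * AB.1 ^ 3 + 27 * AB.2 ^ 2) = 1 ∧
    padicValInt ℓ₂ (4 * AB.1 ^ 3 + 27 * AB.2 ^ 2) = 1

/-! ### (T) The minimal discriminant of `E_{A,B}` at primes `ℓ ≥ 5` (Silverman VII.1.3(b)) -/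

/-- **(T) `v_ℓ(Δ_min(E_{A,B})) = ord_ℓ(4A³ + 27B²)` at every prime `ℓ ≥ 5`**, for `(A, B)` in the
height family (`4A³ + 27B² ≠ 0`, no prime `q` with `q⁴ ∣ A` and `q⁶ ∣ B`) and any globally minimal
model `W = C • E_{A,B}`. Proof (Silverman VII.1 Prop. 1.3(b) with Rem. 1.1, as in the proof of Lemma 17
of Bhargava–Skinner–Zhang: "It follows from [Sil] that `E_{A,B}` is a minimal Weierstrass equation at
`p`"): `E_{A,B}` is `ℓ`-integral and minimal at `ℓ` (tree `isMinimalAt_shortWeierstrass`), `W` is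
`ℓ`-integral and minimal at `ℓ` (tree `IsGloballyMinimal.isMinimalAt_int`), so each of `v(Δ(W))`,
`v(Δ(E_{A,B}))` bounds the other (tree `valuation_Δ_smul_le_of_isMinimalAt`, the definition of
minimality) and they are equal; `Δ(W) = Δ_min`, `Δ(E_{A,B}) = -16(4A³ + 27B²)` and `ℓ ∤ 16`.
[cite: SilvermanAEC2009, VII.1 Prop. 1.3(b) with Rem. 1.1 (p. 186)] -/
theorem padicValInt_minimalDiscriminantInt_smul_shortWeierstrass {AB : ℤ × ℤ}
    (hfam : IsInHeightFamily AB) (W : WeierstrassCurve ℚ) [W.IsElliptic] [W.IsGloballyMinimal]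
    (C : VariableChange ℚ) (hW : C • shortWeierstrass AB = W) {ℓ : ℕ} [hℓ : Fact ℓ.Prime]
    (h5 : 5 ≤ ℓ) :
    padicValInt ℓ W.minimalDiscriminantInt = padicValInt ℓ (4 * AB.1 ^ 3 + 27 * AB.2 ^ 2) := by
  -- the finite place `v` of `ℤ` below `ℓ`
  set v : IsDedekindDomain.HeightOneSpectrum ℤ :=
    (Rat.HeightOneSpectrum.primesEquiv (R := ℤ)).symm ⟨ℓ, hℓ.out⟩
  have hv : Rat.HeightOneSpectrum.natGenerator v = ℓ :=
    congrArg Subtype.val ((Rat.HeightOneSpectrum.primesEquiv (R := ℤ)).apply_symm_apply ⟨ℓ, hℓ.out⟩)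
  -- both equations are `v`-integral and `v`-minimal
  have hminS : (shortWeierstrass AB).IsMinimalAt v :=
    isMinimalAt_shortWeierstrass v (by rw [hv]; exact h5) (by rw [hv]; exact hfam.2 ℓ hℓ.out)
  have hminW : W.IsMinimalAt v := IsGloballyMinimal.isMinimalAt_int W v
  have hSint : shortWeierstrass AB = (⟨0, 0, 0, AB.1, AB.2⟩ : WeierstrassCurve ℤ).baseChange ℚ :=
    BSZLemma17.shortWeierstrass_eq_baseChange AB
  have hintS : (shortWeierstrass AB).IsIntegralAt v := by
    rw [hSint]; exact isIntegralAt_baseChange_int v _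
  have hWint : (integralModelInt W).baseChange ℚ = W := by
    rw [WeierstrassCurve.baseChange, algebraMap_int_eq, map_integralModelInt]
  have hintW : W.IsIntegralAt v := by
    have h := isIntegralAt_baseChange_int v (integralModelInt W)
    rwa [hWint] at h
  -- `v(Δ(W)) = v(Δ(E_{A,B}))`: each is bounded by the other (definition of minimality)
  have h1 : v.valuation ℚ W.Δ ≤ v.valuation ℚ (shortWeierstrass AB).Δ := by
    have h := valuation_Δ_smul_le_of_isMinimalAt v hminS C (by rw [hW]; exact hintW)
    rwa [hW] at h
  have hS' : C⁻¹ • W = shortWeierstrass AB := by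
    rw [← hW, smul_smul, inv_mul_cancel, one_smul]
  have h2 : v.valuation ℚ (shortWeierstrass AB).Δ ≤ v.valuation ℚ W.Δ := by
    have h := valuation_Δ_smul_le_of_isMinimalAt v hminW C⁻¹ (by rw [hS']; exact hintS)
    rwa [hS'] at h
  have heq : v.valuation ℚ W.Δ = v.valuation ℚ (shortWeierstrass AB).Δ := le_antisymm h1 h2
  -- translate into `ℓ`-adic valuations of integers
  have hΔW : W.Δ = (W.minimalDiscriminantInt : ℚ) := (cast_minimalDiscriminantInt W).symm
  have hΔS : (shortWeierstrass AB).Δ = ((-16 * (4 * AB.1 ^ 3 + 27 * AB.2 ^ 2) : ℤ) : ℚ) := by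
    rw [hSint, WeierstrassCurve.baseChange, WeierstrassCurve.map_Δ, BSZLemma17.int_Δ]
    exact eq_intCast _ _
  have h16 : (-16 * (4 * AB.1 ^ 3 + 27 * AB.2 ^ 2) : ℤ) ≠ 0 := mul_ne_zero (by norm_num) hfam.1
  have hneW : (W.minimalDiscriminantInt : ℚ) ≠ 0 := by exact_mod_cast minimalDiscriminantInt_ne_zero W
  have hneS : ((-16 * (4 * AB.1 ^ 3 + 27 * AB.2 ^ 2) : ℤ) : ℚ) ≠ 0 := by exact_mod_cast h16
  rw [hΔW, hΔS, Rat.HeightOneSpectrum.valuation_eq_exp_neg_padicValRat v hneW,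
    Rat.HeightOneSpectrum.valuation_eq_exp_neg_padicValRat v hneS, hv, WithZero.exp_inj, neg_inj,
    padicValRat.of_int, padicValRat.of_int, Nat.cast_inj] at heq
  -- `ord_ℓ(-16 · x) = ord_ℓ(x)` since `ℓ ∤ 16`
  have hnd : ¬ (ℓ : ℤ) ∣ -16 := by
    intro h
    have h' : (ℓ : ℤ) ∣ (2 : ℤ) ^ 4 := by rw [dvd_neg] at h; norm_num; exact h
    have h2 : (ℓ : ℤ) ∣ 2 := (Nat.prime_iff_prime_int.mp hℓ.out).dvd_of_dvd_pow h'
    have := Int.le_of_dvd (by norm_num) h2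
    omega
  rw [heq, padicValInt.mul (by norm_num) hfam.1, padicValInt.eq_zero_of_not_dvd hnd, zero_add]

/-! ### `ord_ℓ(4A³ + 27B²) = 1` at `ℓ ≥ 5` forces multiplicative reduction (BSZ Lemma 17 criteria) -/

/-- `ord_ℓ(x) = 1 ⇒ ℓ ∣ x`. [folklore] -/
theorem natCast_dvd_of_padicValInt_eq_one {ℓ : ℕ} [Fact ℓ.Prime] {x : ℤ}
    (h1 : padicValInt ℓ x = 1) : (ℓ : ℤ) ∣ x := by
  have h := (padicValInt_dvd_iff (p := ℓ) 1 x).mpr (Or.inr h1.ge)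
  rwa [pow_one] at h

/-- If `ℓ ≥ 5` is prime, `4A³ + 27B² ≠ 0` and `ord_ℓ(4A³ + 27B²) = 1`, then `ℓ ∤ A` (else `ℓ ∣ 27B²`,
so `ℓ ∣ B`, so `ℓ² ∣ 4A³ + 27B²`). [folklore] -/
theorem not_dvd_of_padicValInt_eq_one {ℓ : ℕ} [hℓ : Fact ℓ.Prime] {A B : ℤ}
    (hΔ : 4 * A ^ 3 + 27 * B ^ 2 ≠ 0) (h5 : 5 ≤ ℓ)
    (h1 : padicValInt ℓ (4 * A ^ 3 + 27 * B ^ 2) = 1) : ¬ (ℓ : ℤ) ∣ A := by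
  intro hA
  have hprime : Prime (ℓ : ℤ) := Nat.prime_iff_prime_int.mp hℓ.out
  have hx : (ℓ : ℤ) ∣ 4 * A ^ 3 + 27 * B ^ 2 := natCast_dvd_of_padicValInt_eq_one h1
  have h4 : (ℓ : ℤ) ∣ 4 * A ^ 3 := (dvd_pow hA three_ne_zero).mul_left 4
  have h27 : (ℓ : ℤ) ∣ 27 * B ^ 2 := by
    have h := dvd_sub hx h4
    have e : 4 * A ^ 3 + 27 * B ^ 2 - 4 * A ^ 3 = 27 * B ^ 2 := by ring
    rwa [e] at h
  have hB : (ℓ : ℤ) ∣ B := by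
    rcases hprime.dvd_or_dvd h27 with h | h
    · exfalso
      have h3 : (ℓ : ℤ) ∣ 3 := hprime.dvd_of_dvd_pow (n := 3) (by norm_num; exact h)
      have := Int.le_of_dvd (by norm_num) h3
      omega
    · exact hprime.dvd_of_dvd_pow h
  have h2 : (ℓ : ℤ) ^ 2 ∣ 4 * A ^ 3 + 27 * B ^ 2 := by
    refine dvd_add ?_ ?_
    · exact ((pow_dvd_pow_of_dvd hA 2).trans (Dvd.intro (A) (by ring))).mul_left 4
    · exact (pow_dvd_pow_of_dvd hB 2).mul_left 27
  rcases (padicValInt_dvd_iff (p := ℓ) 2 _).mp h2 with h0 | h2'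
  · exact hΔ h0
  · rw [h1] at h2'
    exact absurd h2' (by norm_num)

/-- **For `(A, B)` in the height family and a prime `ℓ ≥ 5` with `ord_ℓ(4A³ + 27B²) = 1`, every model
`C • E_{A,B}` has multiplicative reduction at `ℓ`** (`ℓ ∣ 4A³ + 27B²`, `ℓ ∤ A` — the criterion of
Bhargava–Skinner–Zhang Lemma 17 (proof), tree theorem
`hasMultiplicativeReductionAtPrime_shortWeierstrass_iff_of_isInHeightFamily` — transported by the
isomorphism invariance `hasMultiplicativeReductionAtPrime_smul_iff`).
[cite: BhargavaSkinnerZhang2014, Lemma 17 (proof)] -/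
theorem hasMultiplicativeReductionAtPrime_smul_shortWeierstrass_of_padicValInt_eq_one {AB : ℤ × ℤ}
    (hfam : IsInHeightFamily AB) (C : VariableChange ℚ) {ℓ : ℕ} [Fact ℓ.Prime] (h5 : 5 ≤ ℓ)
    (h1 : padicValInt ℓ (4 * AB.1 ^ 3 + 27 * AB.2 ^ 2) = 1) :
    (C • shortWeierstrass AB).HasMultiplicativeReductionAtPrime ℓ := by
  haveI := isElliptic_shortWeierstrass hfam
  rw [hasMultiplicativeReductionAtPrime_smul_iff (shortWeierstrass AB) C ℓ,
    hasMultiplicativeReductionAtPrime_shortWeierstrass_iff_of_isInHeightFamily (p := ℓ) hfam h5]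
  exact ⟨natCast_dvd_of_padicValInt_eq_one h1, not_dvd_of_padicValInt_eq_one hfam.1 h5 h1⟩

/-! ### The transfer theorem: rank part at proportion `c` ⇒ full BSD off `S_go′` at proportion `c` -/

/-- **Full BSD off `S_go′(E)` for at least the rank-part proportion of curves (row (ii-1) of
`PERCENT-FULL.md`, typed).** If a proportion `≥ c` of the curves `E_{A,B}/ℚ`, ordered by naive
height, satisfy the rank part of BSD with analytic rank `≤ 1` (`rk = r_an ≤ 1`, `Ш` finite), then —
given Duke 1997 Thm. 1 (F1), the density-one hypothesis `hF3` on the two-exact-primes set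
`TwoOrdOnePrimes` ((F3); the `p`-uniform conclusion of the argument of Bhargava–Skinner–Zhang
Lemma 20, NOT a vendored fact — see `TwoOrdOnePrimes`), Skinner–Urban 2014 Thm. 2 (a), W. Zhang 2014
Thm. 1.6/1.4, modularity and Gross–Zagier–Kolyvagin — a proportion `≥ c` satisfy the rank part AND
`BSD(E,p)` at
every prime `p ≥ 5` of good ordinary reduction outside the finite set `Z*(E)`. Proof: intersect with
the two density-one sets (`HeightDensityGE.and_of_one`), then pointwise
`Rank1Residual.bsdp_of_S30_of_WZhang2014` on the minimal model `W = C • E_{A,B}`: `r_an(W) ≤ 1` by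
isomorphism invariance of the analytic rank, `ρ̄_{E,p}` surjective for all `p` from (F1), Zhang's
(2) from `p ∉ Z*(E)`, and two distinct multiplicative `ℓ_i` with `v_{ℓ_i}(Δ_min) = 1` (so
`p ∤ v_{ℓ_i}(Δ_min)`) from `hF3` and the proved transport (T)
`padicValInt_minimalDiscriminantInt_smul_shortWeierstrass`.
[cite: BhargavaSkinnerZhang2014, §1 (Thms 1–2) and Lemma 20 (proof)]
[cite: SkinnerUrban2014, Thm. 2 (a) (p. 3)] [cite: WZhang2014, Thm. 1.6 (p. 199), Thm. 1.4 (p. 197)]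
[cite: Duke1997, Thm. 1 (p. 815)] -/
theorem HeightDensityGE.rankLeOne_and_fullBSDOffSgoPrime
    (hD : Duke1997_exceptionalPrimes_densityZero) (hF3 : HeightDensityGE TwoOrdOnePrimes 1)
    (hS30 : padicValRat_bsd_rank_zero) (hZ : WZhang2014_padicValRat_bsd_rank_one_ordinary)
    (hmod : hasEntireLFunction_rat) (hGZK : rank_eq_analyticRank_of_analyticRank_le_one)
    {c : ℝ} (hA : HeightDensityGE SatisfiesBSDRankLeOne c) :
    HeightDensityGE (fun AB ↦ SatisfiesBSDRankLeOne AB ∧ FullBSDOffSgoPrime AB) c := by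
  have h3 := (hA.and_of_one (heightDensityGE_forall_surj_of_duke hD)).and_of_one hF3
  refine BhargavaSkinnerZhang2014.HeightDensityGE.mono ?_ h3
  rintro AB ⟨⟨hR, hS⟩, hM⟩
  refine ⟨hR, ?_⟩
  intro W _ _ C hW p _ hp hgo hZs
  have hpP : p.Prime := Fact.out
  have hfam : IsInHeightFamily AB := hR.1
  haveI := isElliptic_shortWeierstrass hfam
  -- analytic rank of the minimal model `W = C • E_{A,B}`
  have hr : W.analyticRank ≤ 1 := by
    have e : (C • shortWeierstrass AB).analyticRank = (shortWeierstrass AB).analyticRank :=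
      analyticRank_variableChange_holds (shortWeierstrass AB) C
    rw [← hW, e]
    exact hR.2.2.1
  -- Zhang's (2) at `p` is `p ∉ Z*(E)`
  have hZstar : ∀ (ℓ : ℕ) [Fact ℓ.Prime], W.HasMultiplicativeReductionAtPrime ℓ →
      (p ∣ ℓ - 1 ∨ p ∣ ℓ + 1) → ¬ p ∣ padicValInt ℓ W.minimalDiscriminantInt := by
    intro ℓ iℓ hm hc hv
    exact hZs ⟨ℓ, iℓ, hm, hc, hv⟩
  -- two distinct multiplicative primes with `v_ℓ(Δ_min) = 1`, from `hF3` and (T)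
  obtain ⟨ℓ₁, ℓ₂, hℓ₁, hℓ₂, h5₁, h5₂, hne, hv₁, hv₂⟩ := hM
  haveI i₁ : Fact ℓ₁.Prime := ⟨hℓ₁⟩
  haveI i₂ : Fact ℓ₂.Prime := ⟨hℓ₂⟩
  have hm₁ : W.HasMultiplicativeReductionAtPrime ℓ₁ :=
    hW ▸ hasMultiplicativeReductionAtPrime_smul_shortWeierstrass_of_padicValInt_eq_one hfam C h5₁ hv₁
  have hm₂ : W.HasMultiplicativeReductionAtPrime ℓ₂ :=
    hW ▸ hasMultiplicativeReductionAtPrime_smul_shortWeierstrass_of_padicValInt_eq_one hfam C h5₂ hv₂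
  have hw₁ : padicValInt ℓ₁ W.minimalDiscriminantInt = 1 := by
    rw [padicValInt_minimalDiscriminantInt_smul_shortWeierstrass hfam W C hW h5₁, hv₁]
  have hw₂ : padicValInt ℓ₂ W.minimalDiscriminantInt = 1 := by
    rw [padicValInt_minimalDiscriminantInt_smul_shortWeierstrass hfam W C hW h5₂, hv₂]
  refine Rank1Residual.bsdp_of_S30_of_WZhang2014 W p hS30 hZ hmod hGZK hp hgo (hS W C hW p) hZstar
    ⟨ℓ₁, ℓ₂, i₁, i₂, hne, hm₁, ?_, hm₂, ?_⟩ hr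
  · rw [hw₁]; exact hpP.not_dvd_one
  · rw [hw₂]; exact hpP.not_dvd_one

/-! ### Instances: the printed Bhargava–Skinner–Zhang constant, and Theorem A′'s constant -/

/-- **At bsd.S27's printed constant**: given `bhargava_skinner_zhang` (`≥ 66.48%` satisfy the rank
part, named fact — see its docstring for the caveat on the printed constant), the named facts of
the transfer theorem and the hypothesis `hF3`, at least `66.48%` of elliptic curves over `ℚ`, ordered
by height, satisfy the
rank part of BSD and `BSD(E,p)` at every prime `p ≥ 5` of good ordinary reduction outside `Z*(E)`.
[cite: BhargavaSkinnerZhang2014, Thms 1–2 and Cor. 26] -/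
theorem heightDensityGE_rankLeOne_and_fullBSDOffSgoPrime_of_bsz (hBSZ : bhargava_skinner_zhang)
    (hD : Duke1997_exceptionalPrimes_densityZero) (hF3 : HeightDensityGE TwoOrdOnePrimes 1)
    (hS30 : padicValRat_bsd_rank_zero) (hZ : WZhang2014_padicValRat_bsd_rank_one_ordinary)
    (hmod : hasEntireLFunction_rat) (hGZK : rank_eq_analyticRank_of_analyticRank_le_one) :
    HeightDensityGE (fun AB ↦ SatisfiesBSDRankLeOne AB ∧ FullBSDOffSgoPrime AB) 0.6648 :=
  HeightDensityGE.rankLeOne_and_fullBSDOffSgoPrime hD hF3 hS30 hZ hmod hGZK hBSZ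

/-- **Row (ii-1) of `PERCENT-FULL.md` at `c_rank = 3059480216411717 / 4576171406400000 = 0.66856766…`**
(the constant of Theorem A′ of the `pub-bsdpct` bundle — package `BSDPercentage`, theorem
`bsd_percentage_tierAprime`, corrected Bhargava–Skinner–Zhang densities with the Bhargava–Shankar
5-Selmer input; the package is not part of this tree, so its conclusion enters as the hypothesis
`hA`): IF a proportion `≥ c_rank` satisfies the rank part, then a proportion `≥ c_rank` satisfies the
rank part and `BSD(E,p)` for every `p ∉ S_go′(E)`. [cite: BhargavaSkinnerZhang2014, Thms 1–2] -/
theorem heightDensityGE_rankLeOne_and_fullBSDOffSgoPrime_cRank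
    (hA : HeightDensityGE SatisfiesBSDRankLeOne (3059480216411717 / 4576171406400000))
    (hD : Duke1997_exceptionalPrimes_densityZero) (hF3 : HeightDensityGE TwoOrdOnePrimes 1)
    (hS30 : padicValRat_bsd_rank_zero) (hZ : WZhang2014_padicValRat_bsd_rank_one_ordinary)
    (hmod : hasEntireLFunction_rat) (hGZK : rank_eq_analyticRank_of_analyticRank_le_one) :
    HeightDensityGE (fun AB ↦ SatisfiesBSDRankLeOne AB ∧ FullBSDOffSgoPrime AB)
      (3059480216411717 / 4576171406400000) :=
  HeightDensityGE.rankLeOne_and_fullBSDOffSgoPrime hD hF3 hS30 hZ hmod hGZK hA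

end Literature.NumberTheory.EllipticCurves

end
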